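import Literature.AlgebraicTopology.SingularHomology.CircleLikeProductCohomology
import HarnessLib

/-!
# `Hⁱ⁺²(U × P) ≅ Hⁱ⁺²(U) ⊕ Hⁱ(U)` for a sphere-like space `P` (e.g. `ℂP¹`)

A. Hatcher, *Algebraic Topology* (2002), §3.1 pp. 199–202, continued from
`CircleLikeProductCohomology`: call `P` **sphere-like** (data `A₁, A₂ ⊆ P` and circle-like data on
`↥(A₁ ∩ A₂)`, `IsSphereLike`) if `P = A₁ ∪ A₂` with `A₁`, `A₂` open and contractible and `A₁ ∩ A₂`
circle-like — e.g. `S²` (two open hemispheres meeting in an annulus) or `ℂP¹` (the two affine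
charts, meeting in `ℂ^×`). Then for every space `U`, all coefficients and every `i`,

  `sphereMap : Hⁱ⁺²(U) × Hⁱ(U) → Hⁱ⁺²(U × P)`, `(y, c) ↦ pr₁^* y + κ(T(circleMap (0, c)))`

is a LINEAR BIJECTION (`sphereMap_bijective`; `κ` the boundary-excision map of
`TwoPieceProductCohomology` for the cover `U × A₁, U × A₂`, `T` the identification
`Hⁱ⁺¹(U × (A₁ ∩ A₂)) = Hⁱ⁺¹(↥(U × (A₁ ∩ A₂)))`, `circleMap` the decomposition of
`CircleLikeProductCohomology`), natural in `U` (`map_prodMapId_sphereMap`), with `s^* ∘ sphereMap = pr₁`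
for any slice through `A₁` (`map_sliceAt_sphereMap`); and `pr₁^* : Hᵏ(U) ≅ Hᵏ(U × P)` for `k = 0, 1`
(`map_fst_bijective_zero`, `map_fst_bijective_one`). With `U` a point: `Hⁱ⁺²(P) ≅ Hⁱ(pt)`, so
`H²(P; M) ≅ M` and `Hᵏ(P) = 0` for `k ≠ 0, 2` (sequel `SphereLikeFibre`).

This is the cohomology of a trivialised `ℂP¹`-bundle, the local input of the construction of the
first Chern / Euler class of a complex line bundle via its projective completion `P(L ⊕ ℂ)`.
Everything is proved; no named facts.

## References

* A. Hatcher, *Algebraic Topology*, CUP 2002, §3.1 pp. 199–202; cf. Thm. 3.16. [HatcherAT2002]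
-/

noncomputable section

open CategoryTheory Set

universe u v

namespace Literature.AlgebraicTopology.SingularHomology

variable {U U' : Type u} {Y : Type u} [TopologicalSpace U] [TopologicalSpace U'] [TopologicalSpace Y]

/-- **Sphere-like data on a space `Y`**: `Y = A₁ ∪ A₂` with `A₁, A₂` open and contractible and
circle-like data on `↥(A₁ ∩ A₂)`. [folklore] -/
structure IsSphereLike (Y : Type u) [TopologicalSpace Y] (A₁ A₂ : Set Y) (W₁ W₂ Vp Vm : Set ↥(A₁ ∩ A₂)) : Prop where
  isOpen_left : IsOpen A₁
  isOpen_right : IsOpen A₂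
  union_eq : A₁ ∪ A₂ = univ
  contractible_left : ContractibleSpace ↥A₁
  contractible_right : ContractibleSpace ↥A₂
  circleLike : IsCircleLike ↥(A₁ ∩ A₂) W₁ W₂ Vp Vm

variable (R : Type v) [CommRing R] (M : Type v) [AddCommGroup M] [Module R M]

namespace IsSphereLike

variable {A₁ A₂ : Set Y} {W₁ W₂ Vp Vm : Set ↥(A₁ ∩ A₂)} (hY : IsSphereLike Y A₁ A₂ W₁ W₂ Vp Vm)
include hY

/-- `A₁ ∩ A₂ ≠ ∅`. [folklore] -/
theorem nonempty_inter : (A₁ ∩ A₂).Nonempty :=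
  let ⟨z, _⟩ := hY.circleLike.nonempty_left
  ⟨z, z.2⟩

omit hY in
variable (U A₁ A₂) in
/-- The identification `T : Hⁿ(U × ↥(A₁ ∩ A₂)) → Hⁿ(↥(U × (A₁ ∩ A₂)))` (a homeomorphism). [folklore] -/
abbrev transport (n : ℕ) :
    singularCohomology R M (U × ↥(A₁ ∩ A₂)) n ⟶ singularCohomology R M ↥(inter U A₁ A₂) n :=
  singularCohomology.map R M (interHomeomorph U A₁ A₂ : C(↥(inter U A₁ A₂), U × ↥(A₁ ∩ A₂))) n

omit hY in
/-- `T` is bijective. [folklore] -/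
theorem transport_bijective (n : ℕ) : Function.Bijective (transport U R M A₁ A₂ n) :=
  (singularCohomology.mapIso R M (interHomeomorph U A₁ A₂) n).toLinearEquiv.bijective

omit hY in
/-- `(U × (A₁ ∩ A₂) → U)^* = T ∘ pr₁^*`. [folklore] -/
theorem map_fstInter_eq_transport (n : ℕ) (e : singularCohomology R M U n) :
    singularCohomology.map R M (fstInter U A₁ A₂) n e =
      transport U R M A₁ A₂ n (singularCohomology.map R M (ContinuousMap.fst : C(U × ↥(A₁ ∩ A₂), U)) n e) := by
  rw [fstInter_eq_comp, singularCohomology.map_comp]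
  rfl

/-- **The second summand**: `σ c = κ(T(circleMap (0, c))) : Hⁱ(U) → Hⁱ⁺²(U × Y)`.
[cite: HatcherAT2002, §3.1 pp. 200–202] -/
def sigmaMap (i : ℕ) : singularCohomology R M U i →ₗ[R] singularCohomology R M (U × Y) (i + 2) :=
  (twoPieceKappa R M hY.isOpen_left hY.isOpen_right hY.union_eq (i + 1)).hom ∘ₗ
    (transport U R M A₁ A₂ (i + 1)).hom ∘ₗ (hY.circleLike.circleMap R M (U := U) i) ∘ₗ
      LinearMap.inr R (singularCohomology R M U (i + 1)) (singularCohomology R M U i)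

/-- `σ c = κ(T(circleMap (0, c)))`. [folklore] -/
theorem sigmaMap_apply (i : ℕ) (c : singularCohomology R M U i) :
    (hY.sigmaMap R M i) c = twoPieceKappa R M hY.isOpen_left hY.isOpen_right hY.union_eq (i + 1)
      (transport U R M A₁ A₂ (i + 1) ((hY.circleLike.circleMap R M (U := U) i) (0, c))) :=
  rfl

/-- **`sphereMap (y, c) = pr₁^* y + σ c : Hⁱ⁺²(U) × Hⁱ(U) → Hⁱ⁺²(U × Y)`.**
[cite: HatcherAT2002, §3.1 pp. 200–202] -/
def sphereMap (i : ℕ) :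
    (singularCohomology R M U (i + 2) × singularCohomology R M U i) →ₗ[R] singularCohomology R M (U × Y) (i + 2) :=
  (singularCohomology.map R M (ContinuousMap.fst : C(U × Y, U)) (i + 2)).hom.coprod (hY.sigmaMap R M i)

/-- `sphereMap (y, c) = pr₁^* y + σ c`. [folklore] -/
theorem sphereMap_apply (i : ℕ) (y : singularCohomology R M U (i + 2)) (c : singularCohomology R M U i) :
    (hY.sphereMap R M i) (y, c) =
      singularCohomology.map R M (ContinuousMap.fst : C(U × Y, U)) (i + 2) y + (hY.sigmaMap R M i) c :=
  rfl

/-- **`s^* ∘ sphereMap = pr₁`** for every slice `s` through a point of `A₁`. [cite: HatcherAT2002, §3.1 p. 200] -/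
theorem map_sliceAt_sphereMap {y₁ : Y} (hy₁ : y₁ ∈ A₁) (i : ℕ) (y : singularCohomology R M U (i + 2))
    (c : singularCohomology R M U i) :
    singularCohomology.map R M (sliceAt (U := U) y₁) (i + 2) ((hY.sphereMap R M i) (y, c)) = y := by
  rw [hY.sphereMap_apply R M, map_add, map_sliceAt_map_fst, hY.sigmaMap_apply R M,
    map_sliceAt_twoPieceKappa R M _ _ _ hy₁, add_zero]

/-- `σ c = 0 ↔ c = 0`. [cite: HatcherAT2002, §3.1 pp. 200–202] -/
theorem sigmaMap_eq_zero_iff (i : ℕ) (c : singularCohomology R M U i) : (hY.sigmaMap R M i) c = 0 ↔ c = 0 := by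
  haveI := hY.contractible_left
  haveI := hY.contractible_right
  refine ⟨fun h => ?_, fun h => by rw [h, map_zero]⟩
  rw [hY.sigmaMap_apply R M, twoPieceKappa_eq_zero_iff] at h
  obtain ⟨e, he⟩ := h
  change singularCohomology.map R M (fstInter U A₁ A₂) (i + 1) e = _ at he
  rw [map_fstInter_eq_transport] at he
  have he' := (transport_bijective R M (U := U) (A₁ := A₁) (A₂ := A₂) (i + 1)).1 he
  exact (hY.circleLike.circleMap_mem_range_iff R M i 0 c).1 ⟨e, he'⟩

/-- `sphereMap` is injective. [cite: HatcherAT2002, §3.1 pp. 200–202] -/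
theorem sphereMap_injective (i : ℕ) : Function.Injective (hY.sphereMap R M (U := U) i) := by
  haveI := hY.contractible_left
  rintro ⟨y, c⟩ ⟨y', c'⟩ h
  rw [hY.sphereMap_apply R M, hY.sphereMap_apply R M, hY.sigmaMap_apply R M, hY.sigmaMap_apply R M] at h
  obtain ⟨rfl, hκ⟩ := eq_of_map_fst_add_twoPieceKappa_eq R M hY.isOpen_left hY.isOpen_right hY.union_eq (i + 1) h
  have h0 : (hY.sigmaMap R M i) (c - c') = 0 := by
    rw [map_sub, hY.sigmaMap_apply R M, hY.sigmaMap_apply R M, hκ, sub_self]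
  rw [hY.sigmaMap_eq_zero_iff R M, sub_eq_zero] at h0
  rw [h0]

/-- **`sphereMap` is surjective**: `x = pr₁^*(s^* x) + κ a`, `a = T(circleMap (y'', c)) =
(U × (A₁ ∩ A₂) → U)^* y'' + T(circleMap (0, c))`, and `κ` kills the first term. [cite: HatcherAT2002, §3.1 pp. 200–202] -/
theorem sphereMap_surjective (i : ℕ) : Function.Surjective (hY.sphereMap R M (U := U) i) := by
  haveI := hY.contractible_left
  haveI := hY.contractible_right
  obtain ⟨z₀, hz₀⟩ := hY.nonempty_inter
  intro x
  obtain ⟨a, ha⟩ := exists_eq_map_fst_add_twoPieceKappa R M hY.isOpen_left hY.isOpen_right hY.union_eq hz₀ hz₀.1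
    (i + 1) x
  obtain ⟨a', rfl⟩ := (transport_bijective R M (U := U) (A₁ := A₁) (A₂ := A₂) (i + 1)).2 a
  obtain ⟨⟨y'', c⟩, rfl⟩ := hY.circleLike.circleMap_surjective R M (U := U) i a'
  have hsplit : (hY.circleLike.circleMap R M (U := U) i) (y'', c) =
      singularCohomology.map R M (ContinuousMap.fst : C(U × ↥(A₁ ∩ A₂), U)) (i + 1) y'' +
        (hY.circleLike.circleMap R M (U := U) i) (0, c) := by
    rw [hY.circleLike.circleMap_apply R M, hY.circleLike.circleMap_apply R M, map_zero, zero_add]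
  rw [hsplit, map_add, map_add, ← map_fstInter_eq_transport,
    (twoPieceKappa_eq_zero_iff R M _ _ _ (i + 1) _).2 ⟨_, rfl⟩, zero_add] at ha
  exact ⟨(_, c), ha.symm⟩

/-- **`Hⁱ⁺²(U) × Hⁱ(U) ≅ Hⁱ⁺²(U × Y)` for sphere-like `Y`.** [cite: HatcherAT2002, §3.1 pp. 200–202] -/
theorem sphereMap_bijective (i : ℕ) : Function.Bijective (hY.sphereMap R M (U := U) i) :=
  ⟨hY.sphereMap_injective R M i, hY.sphereMap_surjective R M i⟩

/-- `Hⁱ⁺²(U) × Hⁱ(U) ≃ₗ Hⁱ⁺²(U × Y)` for sphere-like `Y`. [cite: HatcherAT2002, §3.1 pp. 200–202] -/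
def sphereEquiv (i : ℕ) :
    (singularCohomology R M U (i + 2) × singularCohomology R M U i) ≃ₗ[R] singularCohomology R M (U × Y) (i + 2) :=
  LinearEquiv.ofBijective (hY.sphereMap R M i) (hY.sphereMap_bijective R M i)

/-- The equivalence is `sphereMap`. [folklore] -/
@[simp]
theorem sphereEquiv_apply (i : ℕ) (p : singularCohomology R M U (i + 2) × singularCohomology R M U i) :
    (hY.sphereEquiv R M i) p = (hY.sphereMap R M i) p := rfl

/-- **A class of `Hⁱ⁺²(U × Y)` is pulled back from `U` iff its second coordinate vanishes.**
[cite: HatcherAT2002, §3.1 pp. 200–202] -/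
theorem sphereMap_mem_range_iff (i : ℕ) (y : singularCohomology R M U (i + 2)) (c : singularCohomology R M U i) :
    (hY.sphereMap R M i) (y, c) ∈
        LinearMap.range (singularCohomology.map R M (ContinuousMap.fst : C(U × Y, U)) (i + 2)).hom ↔ c = 0 := by
  refine ⟨fun ⟨y', hy'⟩ => ?_, fun h => ⟨y, by rw [h, hY.sphereMap_apply R M, map_zero, add_zero]⟩⟩
  have : (hY.sphereMap R M i) (y', 0) = (hY.sphereMap R M i) (y, c) := by
    rw [← hy', hY.sphereMap_apply R M, map_zero, add_zero]
  exact ((Prod.ext_iff.1 (hY.sphereMap_injective R M i this)).2).symm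

/-- **`pr₁^* : H⁰(U) ≅ H⁰(U × Y)`.** [cite: HatcherAT2002, §3.1 pp. 200–201] -/
theorem map_fst_bijective_zero : Function.Bijective (singularCohomology.map R M (ContinuousMap.fst : C(U × Y, U)) 0) := by
  haveI := hY.contractible_left
  haveI := hY.contractible_right
  obtain ⟨z₀, hz₀⟩ := hY.nonempty_inter
  exact SingularHomology.map_fst_bijective_zero R M hY.isOpen_left hY.isOpen_right hY.union_eq hz₀

/-- **`pr₁^* : H¹(U) ≅ H¹(U × Y)`** (`H⁰` of the circle-like `U × (A₁ ∩ A₂)` is pulled back from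
`U`, so `κ` vanishes on it). [cite: HatcherAT2002, §3.1 pp. 200–202] -/
theorem map_fst_bijective_one : Function.Bijective (singularCohomology.map R M (ContinuousMap.fst : C(U × Y, U)) 1) := by
  haveI := hY.contractible_left
  haveI := hY.contractible_right
  obtain ⟨z₀, hz₀⟩ := hY.nonempty_inter
  refine ⟨Function.LeftInverse.injective fun y => map_sliceAt_map_fst R M (C := Y) z₀ 1 y, fun x => ?_⟩
  obtain ⟨a, ha⟩ := exists_eq_map_fst_add_twoPieceKappa R M hY.isOpen_left hY.isOpen_right hY.union_eq hz₀ hz₀.1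
    0 x
  obtain ⟨a', rfl⟩ := (transport_bijective R M (U := U) (A₁ := A₁) (A₂ := A₂) 0).2 a
  obtain ⟨e, rfl⟩ := (hY.circleLike.map_fst_bijective_zero R M (U := U)).2 a'
  rw [← map_fstInter_eq_transport, (twoPieceKappa_eq_zero_iff R M _ _ _ 0 _).2 ⟨_, rfl⟩, add_zero] at ha
  exact ⟨_, ha.symm⟩

/-! ### Naturality in `U` -/

omit hY in
/-- `T` is natural in `U`. [folklore] -/
theorem map_prodMapIdInter_transport (g : C(U', U)) (n : ℕ) (a : singularCohomology R M (U × ↥(A₁ ∩ A₂)) n) :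
    singularCohomology.map R M (prodMapIdInter g A₁ A₂) n (transport U R M A₁ A₂ n a) =
      transport U' R M A₁ A₂ n (singularCohomology.map R M (prodMapId g) n a) := by
  rw [← ModuleCat.comp_apply, ← ModuleCat.comp_apply, ← singularCohomology.map_comp, ← singularCohomology.map_comp,
    interHomeomorph_comp_prodMapIdInter]

/-- **`σ` is natural in `U`.** [cite: HatcherAT2002, §3.1 p. 200] -/
theorem map_prodMapId_sigmaMap (g : C(U', U)) (i : ℕ) (c : singularCohomology R M U i) :
    singularCohomology.map R M (prodMapId g) (i + 2) ((hY.sigmaMap R M (U := U) i) c) =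
      (hY.sigmaMap R M (U := U') i) (singularCohomology.map R M g i c) := by
  rw [hY.sigmaMap_apply R M, hY.sigmaMap_apply R M, map_prodMapId_twoPieceKappa, map_prodMapIdInter_transport,
    hY.circleLike.map_prodMapId_circleMap R M, map_zero]

/-- **`sphereMap` is natural in `U`**: `(g × 𝟙)^* sphereMap_U (y, c) = sphereMap_{U'} (g^* y, g^* c)`.
[cite: HatcherAT2002, §3.1 p. 200] -/
theorem map_prodMapId_sphereMap (g : C(U', U)) (i : ℕ) (y : singularCohomology R M U (i + 2))
    (c : singularCohomology R M U i) :
    singularCohomology.map R M (prodMapId g) (i + 2) ((hY.sphereMap R M (U := U) i) (y, c)) =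
      (hY.sphereMap R M (U := U') i) (singularCohomology.map R M g (i + 2) y, singularCohomology.map R M g i c) := by
  rw [hY.sphereMap_apply R M, hY.sphereMap_apply R M, map_add, hY.map_prodMapId_sigmaMap R M,
    ← ModuleCat.comp_apply, ← ModuleCat.comp_apply, ← singularCohomology.map_comp, ← singularCohomology.map_comp]
  rfl

end IsSphereLike

end Literature.AlgebraicTopology.SingularHomology
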